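import Summits.HodgeConjecture.CorCM.GaloisDihedralDegenerateTypes
import Summits.HodgeConjecture.CorCM.GaloisSixteenDihedralCensus
import Summits.HodgeConjecture.CorCM.GaloisSixteenAllTypes
import Summits.HodgeConjecture.CorCM.CMFieldSmallDegreeAllTypes
import HarnessLib

/-!
# THE DIHEDRAL CLASSIFICATION: for a Galois CM field with Galois group the dihedral group of order `4n`, every simple
# CM abelian variety is nondegenerate ⟺ `n ≤ 4` ⟺ every abelian variety with CM by the field is stably nondegenerate

COR-CM (cell `pub-hodgecm2`), binder seat b04 (gen 22), count-neutral claim GALOIS-DIHEDRAL, part IV — THE THEOREM.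
KERNEL ONLY: theorems; no definition, no named fact, no `sorry`.  `HC_CM` is neither used nor claimed: this is the Hodge
conjecture for a NAMED CLASS of abelian varieties, UNCONDITIONALLY, together with its exact boundary inside the
dihedral family.

Let `K` be a Galois CM field with `e : Gal(K/ℚ) ≃* DihedralGroup (2n)` (Mathlib; order `4n`, complex conjugation
`= rⁿ` for `n ≥ 2`).  THEN THE FOLLOWING ARE EQUIVALENT (§3):
(a) every PRIMITIVE CM type of `K` is nondegenerate; (b) every SIMPLE abelian variety of dimension `2n` with CM by `K`
is nondegenerate (Kubota rank `2n + 1`; `B = D` on all powers; the Hodge conjecture for all powers, Hazama / Gordon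
Thm. 6.4); (c) EVERY complex abelian variety `X` with `K ↪ End⁰(X)` and `[K:ℚ] = 2 dim X` is STABLY NONDEGENERATE;
(d) `n ≤ 4`.
* (d) ⟹ (a),(c) (§1–§2, BY NAME): `n = 1, 2, 3` — degree `4`, Galois octic, Galois dodecic with NON-ABELIAN group
  (`GaloisDodecic.isNondegenerate_of_isPrimitive_of_finrank_le_twelve`, `SmallDegreeAllTypes.isStablyNondegenerate_of_
  finrank_le_twelve`; gens 13–14, 21); `n = 4` — the census of the dihedral group of order `16`
  (`GaloisSixteenDihedral.isNondegenerate_d16`, gen 16) and `GaloisSixteenAllTypes.isStablyNondegenerate_of_not_isSimple_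
  sixteen` (gen 21).
* ¬(d) ⟹ ¬(a),¬(b),¬(c) (part III `exists_simple_degenerate_of_mulEquiv_dihedral`): for `n ≥ 5` the mirror types
  (`n ≥ 6`) and the order-`20` certificate (`n = 5`) give SIMPLE DEGENERATE CM abelian varieties of dimension `2n`.
So among the dihedral Galois groups `D₄, D₈, D₁₂, D₁₆, D₂₀, D₂₄, …` (orders `4, 8, 12, 16, 20, 24, …`) exactly the first
four are «good», completing the rows `D₈(16)` good (gen 16), `D₁₂(24)`, `D₁₆(32)` bad (gen 20 certificates), `D₂₀(40)`
bad (gen 20 census) of the b04 classification to ALL `n` by one mechanism.  §4: the Hodge conjecture for every abelian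
variety with CM by `K` and everything isogenous to a power, `n ≤ 4` (no simplicity hypothesis); the dichotomy display;
`HCOnClass`.

## References

* [Shimura1998] G. Shimura, *Abelian Varieties with Complex Multiplication and Modular Functions*, §5.1 Prop. 3,
  §6.2 Thm. 3, §8.2 Prop. 26.
* [Gordon1999HodgeAVSurvey] B. B. Gordon, *A survey of the Hodge conjecture for abelian varieties*, 5.13, Thm. 6.3–6.4,
  Def. 7.6, §9.3–9.4.
* [Kubota1965] T. Kubota, Trans. AMS 118 (1965), §2, §4 Lemma 2.
* [Dodson1984] B. Dodson, *The structure of Galois groups of CM-fields*, Trans. AMS 283 (1984), §3.3.1–3.3.2, §4.1.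
* [vanGeemen1994HodgeAV] B. van Geemen, *An introduction to the Hodge conjecture for abelian varieties*, Lemma 3.7.
-/

noncomputable section

open CategoryTheory CategoryTheory.Limits NumberField

namespace Summit.HodgeConjecture.CorCM.GaloisDihedral

open Literature.NumberTheory.ComplexMultiplication
open Literature.AlgebraicGeometry Literature.AlgebraicGeometry.Motives Literature.AlgebraicGeometry.HodgeTheory
open Literature.AlgebraicGeometry.Motives.AbelianVariety
open Literature.AlgebraicGeometry.ComplexMultiplication
open Literature.AlgebraicGeometry.Pohlmann1968
open Summit.HodgeConjecture.HodgeConjecture.Ring2.ClassTargets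
open Summit.HodgeConjecture.CorCM.AbelianSixteen (exists_simple_realisation_of_isPrimitive)
open DihedralGroup

variable {K : Type} [Field K] [NumberField K] [IsCMField K] [IsGalois ℚ K]
variable {n : ℕ}

/-! ## §1 `n ≤ 4`: every primitive CM type is nondegenerate -/

omit [IsCMField K] [IsGalois ℚ K] in
/-- The dihedral group of order `12` is not commutative, read on `Gal(K/ℚ)`. [folklore] -/
theorem exists_not_commute_of_mulEquiv_dihedral_six (e : (K ≃ₐ[ℚ] K) ≃* DihedralGroup (2 * 3)) :
    ∃ x y : K ≃ₐ[ℚ] K, x * y ≠ y * x := by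
  refine ⟨e.symm (sr 0), e.symm (r 1), fun h => ?_⟩
  have h' := congrArg e h
  rw [map_mul, map_mul, MulEquiv.apply_symm_apply, MulEquiv.apply_symm_apply] at h'
  exact absurd h' (by decide)

/-- **`n ≤ 4`: every PRIMITIVE CM type of `K` is NONDEGENERATE** — degree `≤ 12` by gens 13–14 (`D₆` of order `12` is
non-abelian), degree `16` by the `D₈(16)` census of gen 16. [cite: Dodson1984, §3.3.2 Theorem (p. 16), §4 (p. 18)]
[cite: Shimura1998, §8.2 Prop. 26] [cite: Kubota1965, §2] -/
theorem isNondegenerate_of_isPrimitive_dihedral_of_le_four (hn : n ≤ 4) (e : (K ≃ₐ[ℚ] K) ≃* DihedralGroup (2 * n))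
    {Φ : CMType K} (φ₀ : K →+* ℂ) (hprim : IsPrimitive (ℂ ≃+* ℂ) Φ.1 φ₀) : IsNondegenerate Φ := by
  have hK := finrank_eq_four_mul e
  rcases (show n ≤ 3 ∨ n = 4 by omega) with h3 | rfl
  · refine GaloisDodecic.isNondegenerate_of_isPrimitive_of_finrank_le_twelve (by omega) (fun _ => inferInstance)
      (fun h12 => ⟨inferInstance, Or.inl ?_⟩) φ₀ hprim
    obtain rfl : n = 3 := by omega
    exact exists_not_commute_of_mulEquiv_dihedral_six e
  · have hc := map_complexConj_eq_r (n := 4) (by norm_num) e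
    simp only [Nat.cast_ofNat] at hc
    exact GaloisSixteenDihedral.isNondegenerate_d16 e hc φ₀ hprim

variable {Φ : CMType K} {A : AbelianVariety ℂ} {ι : 𝓞 K →+* End A} {θ : K →+* Module.End ℂ (complexBetti A.X 1)}

/-- **`n ≤ 4`: every SIMPLE abelian variety with CM by `K` realises a nondegenerate type** (`A` simple ⟺ `Φ` primitive,
Shimura §8.2 Prop. 26). [cite: Shimura1998, §8.2 Prop. 26] [cite: Gordon1999HodgeAVSurvey, Thm. 6.4] -/
theorem isNondegenerate_of_isSimple_dihedral_of_le_four (hn : n ≤ 4) (e : (K ≃ₐ[ℚ] K) ≃* DihedralGroup (2 * n))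
    (hA : IsCMTypeRealisation Φ A ι θ) (hs : A.IsSimple) : IsNondegenerate Φ := by
  obtain ⟨φ₀⟩ := (inferInstance : Nonempty (K →+* ℂ))
  exact isNondegenerate_of_isPrimitive_dihedral_of_le_four hn e φ₀ ((isSimple_iff_isPrimitive hA φ₀).1 hs)

/-! ## §2 `n ≤ 4`: EVERY abelian variety with CM by `K` is stably nondegenerate -/

/-- **THEOREM (`n ≤ 4`, all abelian varieties).**  `Gal(K/ℚ) ≅ DihedralGroup (2n)` with `n ≤ 4`: EVERY complex abelian
variety `X` with `φ : K →+* End⁰(X)` and `[K:ℚ] = 2 dim X` — simple or not, of any CM type — is STABLY NONDEGENERATE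
(`B = D` on all powers). UNCONDITIONAL. [cite: Gordon1999HodgeAVSurvey, Thm. 6.4 and Def. 7.6]
[cite: Shimura1998, §5.1 Prop. 3 and §8.2 Prop. 26] [cite: Dodson1984, §3.3.2] -/
theorem isStablyNondegenerate_dihedral_of_le_four (hn : n ≤ 4) (e : (K ≃ₐ[ℚ] K) ≃* DihedralGroup (2 * n))
    {X : AbelianVariety ℂ} (φ : K →+* X.endAlgebra) (hX : Module.finrank ℚ K = 2 * X.dim) :
    IsStablyNondegenerate X := by
  have hK := finrank_eq_four_mul e
  rcases (show n ≤ 3 ∨ n = 4 by omega) with h3 | rfl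
  · refine SmallDegreeAllTypes.isStablyNondegenerate_of_finrank_le_twelve (by omega) (fun _ => inferInstance)
      (fun h12 => ⟨inferInstance, Or.inl ?_⟩) φ hX
    obtain rfl : n = 3 := by omega
    exact exists_not_commute_of_mulEquiv_dihedral_six e
  · by_cases hs : X.IsSimple
    · obtain ⟨φ₀⟩ := (inferInstance : Nonempty (K →+* ℂ))
      have hprim := (isPrimitive_ringEquiv_complex_iff _ φ₀).2
        ((EndFieldFullDegree.isSimple_iff_primitive_cmTypeOfPair φ hX).1 hs)
      exact EndFieldFullDegree.isStablyNondegenerate_of_isNondegenerate_cmTypeOfPair φ hX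
        (isNondegenerate_of_isPrimitive_dihedral_of_le_four le_rfl e φ₀ hprim)
    · exact GaloisSixteenAllTypes.isStablyNondegenerate_of_not_isSimple_sixteen (by omega) φ hX hs

/-! ## §3 THE CLASSIFICATION -/

/-- **THE DIHEDRAL CLASSIFICATION (type level).**  `K` Galois CM with `Gal(K/ℚ) ≅ DihedralGroup (2n)` (order `4n`):
every PRIMITIVE CM type of `K` is NONDEGENERATE ⟺ `n ≤ 4`. [cite: Kubota1965, §2] [cite: Shimura1998, §8.2 Prop. 26]
[cite: Dodson1984, §3.3.1 (C) and §3.3.2] -/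
theorem forall_isPrimitive_isNondegenerate_iff_dihedral (e : (K ≃ₐ[ℚ] K) ≃* DihedralGroup (2 * n)) :
    (∀ (Φ : CMType K) (φ₀ : K →+* ℂ), IsPrimitive (ℂ ≃+* ℂ) Φ.1 φ₀ → IsNondegenerate Φ) ↔ n ≤ 4 := by
  refine ⟨fun h => ?_, fun hn Φ φ₀ hprim => isNondegenerate_of_isPrimitive_dihedral_of_le_four hn e φ₀ hprim⟩
  by_contra hlt
  obtain ⟨φ₀⟩ := (inferInstance : Nonempty (K →+* ℂ))
  obtain ⟨Φ, hprim, hdeg⟩ := exists_isPrimitive_not_isNondegenerate_dihedral (by omega) e φ₀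
  exact hdeg (h Φ φ₀ hprim)

/-- **THE DIHEDRAL CLASSIFICATION (simple abelian varieties).**  `Gal(K/ℚ) ≅ DihedralGroup (2n)`: every SIMPLE abelian
variety with complex multiplication by `K` is NONDEGENERATE — hence satisfies the Hodge conjecture with all its powers —
⟺ `n ≤ 4`; for `n ≥ 5` simple DEGENERATE ones of dimension `2n` exist. [cite: Gordon1999HodgeAVSurvey, Thm. 6.4]
[cite: Shimura1998, §6.2 Thm. 3 and §8.2 Prop. 26] -/
theorem forall_isSimple_isNondegenerate_iff_dihedral (e : (K ≃ₐ[ℚ] K) ≃* DihedralGroup (2 * n)) :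
    (∀ (Φ : CMType K) (A : AbelianVariety ℂ) (ι : 𝓞 K →+* End A) (θ : K →+* Module.End ℂ (complexBetti A.X 1)),
      IsCMTypeRealisation Φ A ι θ → A.IsSimple → IsNondegenerate Φ) ↔ n ≤ 4 := by
  rw [← forall_isPrimitive_isNondegenerate_iff_dihedral e]
  constructor
  · intro h Φ φ₀ hprim
    obtain ⟨A, ι, θ, hA, hs, -⟩ := exists_simple_realisation_of_isPrimitive Φ φ₀ hprim
    exact h Φ A ι θ hA hs
  · intro h Φ A ι θ hA hs
    obtain ⟨φ₀⟩ := (inferInstance : Nonempty (K →+* ℂ))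
    exact h Φ φ₀ ((isSimple_iff_isPrimitive hA φ₀).1 hs)

/-- **THE DIHEDRAL CLASSIFICATION (all abelian varieties).**  `Gal(K/ℚ) ≅ DihedralGroup (2n)`: EVERY complex abelian
variety `X` with `K ↪ End⁰(X)`, `[K:ℚ] = 2 dim X`, is STABLY NONDEGENERATE ⟺ `n ≤ 4` — the same boundary as for simple
varieties. [cite: Gordon1999HodgeAVSurvey, Thm. 6.4 and Def. 7.6] [cite: Shimura1998, §6.2 Thm. 3 and §8.2 Prop. 26] -/
theorem forall_isStablyNondegenerate_iff_dihedral (e : (K ≃ₐ[ℚ] K) ≃* DihedralGroup (2 * n)) :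
    (∀ (X : AbelianVariety ℂ) (_ : K →+* X.endAlgebra), Module.finrank ℚ K = 2 * X.dim → IsStablyNondegenerate X) ↔
      n ≤ 4 := by
  refine ⟨fun h => ?_, fun hn X φ hX => isStablyNondegenerate_dihedral_of_le_four hn e φ hX⟩
  by_contra hlt
  obtain ⟨Φ, φ₀, A, ι, θ, hprim, hdeg, hA, -, -, -⟩ := exists_simple_degenerate_of_mulEquiv_dihedral (by omega) e
  obtain ⟨i, -⟩ := exists_ringHom_endAlgebra ι
  exact hdeg ((isStablyNondegenerate_iff_isNondegenerate φ₀ hprim hA).1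
    (h A i (finrank_eq_two_mul_dim_of_isCMTypeRealisation hA)))

/-- **The same in the realisation vocabulary**: every abelian variety `(A, ι)` of ANY CM type `(K; Φ)` is stably
nondegenerate ⟺ `n ≤ 4`. [cite: Gordon1999HodgeAVSurvey, Thm. 6.4] [cite: Shimura1998, §8.2 Prop. 26] -/
theorem forall_realisation_isStablyNondegenerate_iff_dihedral (e : (K ≃ₐ[ℚ] K) ≃* DihedralGroup (2 * n)) :
    (∀ (Φ : CMType K) (A : AbelianVariety ℂ) (ι : 𝓞 K →+* End A) (θ : K →+* Module.End ℂ (complexBetti A.X 1)),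
        IsCMTypeRealisation Φ A ι θ → IsStablyNondegenerate A) ↔ n ≤ 4 := by
  constructor
  · intro h
    by_contra hlt
    obtain ⟨Φ, φ₀, A, ι, θ, hprim, hdeg, hA, -, -, -⟩ := exists_simple_degenerate_of_mulEquiv_dihedral (by omega) e
    exact hdeg ((isStablyNondegenerate_iff_isNondegenerate φ₀ hprim hA).1 (h Φ A ι θ hA))
  · intro hn Φ A ι θ hA
    obtain ⟨i, -⟩ := exists_ringHom_endAlgebra ι
    exact isStablyNondegenerate_dihedral_of_le_four hn e i (finrank_eq_two_mul_dim_of_isCMTypeRealisation hA)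

/-! ## §4 The Hodge conjecture for `n ≤ 4`; the dichotomy -/

/-- **THE HODGE CONJECTURE FOR EVERY POWER OF EVERY ABELIAN VARIETY WITH COMPLEX MULTIPLICATION BY A GALOIS CM FIELD
WHOSE GALOIS GROUP IS DIHEDRAL OF ORDER `4n ≤ 16`** — unconditionally, no simplicity hypothesis.
[cite: Gordon1999HodgeAVSurvey, 5.13 (i) and Thm. 6.4] [cite: Shimura1998, §8.2 Prop. 26] -/
theorem hodgeConjectureFor_pow_dihedral_of_le_four (hn : n ≤ 4) (e : (K ≃ₐ[ℚ] K) ≃* DihedralGroup (2 * n))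
    (hA : IsCMTypeRealisation Φ A ι θ) (N : ℕ) :
    HodgeConjectureFor (⨁ fun _ : Fin N => A).dim (⨁ fun _ : Fin N => A).X := by
  obtain ⟨i, -⟩ := exists_ringHom_endAlgebra ι
  exact hodgeConjectureFor_of_isDivisorGenerated _
    ((isStablyNondegenerate_iff_forall_isDivisorGenerated_biproduct A).1
      (isStablyNondegenerate_dihedral_of_le_four hn e i (finrank_eq_two_mul_dim_of_isCMTypeRealisation hA)) N)

/-- **… and for everything isogenous to a power of an `X` with `K ↪ End⁰(X)`, `[K:ℚ] = 2 dim X`** (`n ≤ 4`).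
[cite: Gordon1999HodgeAVSurvey, Thm. 6.3–6.4] [cite: vanGeemen1994HodgeAV, Lemma 3.7] -/
theorem hodgeConjectureFor_of_isIsogenous_powSucc_dihedral_of_le_four (hn : n ≤ 4)
    (e : (K ≃ₐ[ℚ] K) ≃* DihedralGroup (2 * n)) {X : AbelianVariety ℂ} (φ : K →+* X.endAlgebra)
    (hX : Module.finrank ℚ K = 2 * X.dim) {B : AbelianVariety ℂ} {N : ℕ} (h : IsIsogenous B (X.powSucc N)) :
    HodgeConjectureFor B.dim B.X :=
  (isStablyNondegenerate_dihedral_of_le_four hn e φ hX).hodgeConjectureFor_of_isIsogenous_powSucc h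

/-- **Dichotomy display**: either the Hodge conjecture holds for all powers of every abelian variety with CM by `K`, or
a simple degenerate one of dimension `2n` (with an exceptional Hodge class on a power) exists — according as `n ≤ 4` or
`n ≥ 5`. [cite: Gordon1999HodgeAVSurvey, Thm. 6.4] [cite: Shimura1998, §6.2 Thm. 3] -/
theorem hodgeConjectureFor_pow_or_exists_simple_degenerate_dihedral (e : (K ≃ₐ[ℚ] K) ≃* DihedralGroup (2 * n)) :
    (∀ (Φ : CMType K) (A : AbelianVariety ℂ) (ι : 𝓞 K →+* End A) (θ : K →+* Module.End ℂ (complexBetti A.X 1)),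
      IsCMTypeRealisation Φ A ι θ → ∀ N : ℕ,
        HodgeConjectureFor (⨁ fun _ : Fin N => A).dim (⨁ fun _ : Fin N => A).X) ∨
    (∃ (Φ : CMType K) (φ₀ : K →+* ℂ) (A : AbelianVariety ℂ) (ι : 𝓞 K →+* End A)
      (θ : K →+* Module.End ℂ (complexBetti A.X 1)),
      IsPrimitive (ℂ ≃+* ℂ) Φ.1 φ₀ ∧ ¬ IsNondegenerate Φ ∧ IsCMTypeRealisation Φ A ι θ ∧ A.IsSimple ∧
      A.dim = 2 * n) := by
  by_cases hn : n ≤ 4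
  · exact Or.inl fun Φ A ι θ hA N => hodgeConjectureFor_pow_dihedral_of_le_four hn e hA N
  · right
    obtain ⟨Φ, φ₀, A, ι, θ, hprim, hdeg, hA, hs, hdim, -⟩ := exists_simple_degenerate_of_mulEquiv_dihedral (by omega) e
    exact ⟨Φ, φ₀, A, ι, θ, hprim, hdeg, hA, hs, hdim⟩

/-- **HC on the class «isogenous to a power of an abelian variety `X` carrying an action of a Galois CM field of degree
`2 dim X` whose Galois group is dihedral of order `4n ≤ 16`»** — UNCONDITIONAL, no simplicity.
[cite: Gordon1999HodgeAVSurvey, Thm. 6.3–6.4] -/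
theorem hcOnClass_isIsogenous_powSucc_galoisCM_dihedral :
    HCOnClass fun B ↦ ∃ (X : AbelianVariety ℂ) (N : ℕ) (K : Type) (_ : Field K) (_ : NumberField K)
      (_ : IsCMField K) (_ : IsGalois ℚ K) (n : ℕ), n ≤ 4 ∧ Nonempty ((K ≃ₐ[ℚ] K) ≃* DihedralGroup (2 * n)) ∧
      Module.finrank ℚ K = 2 * X.dim ∧ Nonempty (K →+* X.endAlgebra) ∧ IsIsogenous B (X.powSucc N) := by
  rintro B ⟨X, N, K, _, _, _, _, n, hn, ⟨e⟩, hX, ⟨φ⟩, h⟩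
  exact (isStablyNondegenerate_dihedral_of_le_four hn e φ hX).hodgeConjectureFor_of_isIsogenous_powSucc h

/-! ## §5 All `m`: `Gal(K/ℚ) ≅ DihedralGroup m` forces `m = 1` or `m` even; GOOD ⟺ `m ≤ 8` -/

/-- **A Galois CM field with dihedral Galois group `DihedralGroup m` has `m = 1` or `m` even**: for odd `m ≥ 3` the
centre is trivial, but complex conjugation is a central involution. [cite: Shimura1998, §18.2 Lemma (i)] -/
theorem eq_one_or_even_of_mulEquiv_dihedral {m : ℕ} (e : (K ≃ₐ[ℚ] K) ≃* DihedralGroup m) :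
    m = 1 ∨ Even m := by
  by_contra h
  rw [not_or, Nat.not_even_iff_odd] at h
  have hmem : e ((IsCMField.complexConj K).restrictScalars ℚ) ∈ Subgroup.center (DihedralGroup m) :=
    Subgroup.mem_center_iff.2 fun g => (GaloisRank.model_complexConj_comm e rfl g).symm
  rw [DihedralGroup.center_eq_bot_of_odd_ne_one h.2 h.1, Subgroup.mem_bot] at hmem
  exact GaloisRank.model_complexConj_ne_one e rfl hmem

/-- **THE DIHEDRAL CLASSIFICATION over all `m`.**  `K` Galois CM with `Gal(K/ℚ) ≅ DihedralGroup m` (order `2m`; so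
`m = 1` — `K` imaginary quadratic — or `m` even): every PRIMITIVE CM type of `K` is nondegenerate ⟺ `m ≤ 8`, i.e. the
good dihedral Galois groups of CM fields are exactly `D₁ ≅ C₂, D₂ ≅ C₂², D₄, D₆, D₈` (orders `2, 4, 8, 12, 16`).
[cite: Kubota1965, §2] [cite: Shimura1998, §8.2 Prop. 26] [cite: Dodson1984, §3.3.1 (C) and §3.3.2] -/
theorem forall_isPrimitive_isNondegenerate_iff_dihedral_all {m : ℕ} (e : (K ≃ₐ[ℚ] K) ≃* DihedralGroup m) :
    (∀ (Φ : CMType K) (φ₀ : K →+* ℂ), IsPrimitive (ℂ ≃+* ℂ) Φ.1 φ₀ → IsNondegenerate Φ) ↔ m ≤ 8 := by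
  rcases eq_one_or_even_of_mulEquiv_dihedral e with rfl | ⟨n, rfl⟩
  · -- `m = 1`: `K` is imaginary quadratic, every CM type is nondegenerate
    have hK : Module.finrank ℚ K = 2 := by
      rw [← IsGalois.card_aut_eq_finrank, Nat.card_congr e.toEquiv, DihedralGroup.nat_card]
    refine ⟨fun _ => by norm_num, fun _ Φ φ₀ hprim => ?_⟩
    exact GaloisDodecic.isNondegenerate_of_isPrimitive_of_finrank_le_twelve (by omega) (fun _ => inferInstance)
      (fun h12 => by omega) φ₀ hprim
  · rw [← two_mul] at e
    rw [forall_isPrimitive_isNondegenerate_iff_dihedral e]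
    omega

/-- **… and for SIMPLE abelian varieties over all `m`**: every simple abelian variety with CM by `K` is nondegenerate
⟺ `m ≤ 8`. [cite: Gordon1999HodgeAVSurvey, Thm. 6.4] [cite: Shimura1998, §6.2 Thm. 3 and §8.2 Prop. 26] -/
theorem forall_isSimple_isNondegenerate_iff_dihedral_all {m : ℕ} (e : (K ≃ₐ[ℚ] K) ≃* DihedralGroup m) :
    (∀ (Φ : CMType K) (A : AbelianVariety ℂ) (ι : 𝓞 K →+* End A) (θ : K →+* Module.End ℂ (complexBetti A.X 1)),
      IsCMTypeRealisation Φ A ι θ → A.IsSimple → IsNondegenerate Φ) ↔ m ≤ 8 := by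
  rw [← forall_isPrimitive_isNondegenerate_iff_dihedral_all e]
  constructor
  · intro h Φ φ₀ hprim
    obtain ⟨A, ι, θ, hA, hs, -⟩ := exists_simple_realisation_of_isPrimitive Φ φ₀ hprim
    exact h Φ A ι θ hA hs
  · intro h Φ A ι θ hA hs
    obtain ⟨φ₀⟩ := (inferInstance : Nonempty (K →+* ℂ))
    exact h Φ φ₀ ((isSimple_iff_isPrimitive hA φ₀).1 hs)

/-- **… and for ALL abelian varieties over all `m`**: every `X` with `K ↪ End⁰(X)`, `[K:ℚ] = 2 dim X`, is stably
nondegenerate ⟺ `m ≤ 8`. [cite: Gordon1999HodgeAVSurvey, Thm. 6.4 and Def. 7.6] [cite: Shimura1998, §8.2 Prop. 26] -/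
theorem forall_isStablyNondegenerate_iff_dihedral_all {m : ℕ} (e : (K ≃ₐ[ℚ] K) ≃* DihedralGroup m) :
    (∀ (X : AbelianVariety ℂ) (_ : K →+* X.endAlgebra), Module.finrank ℚ K = 2 * X.dim → IsStablyNondegenerate X) ↔
      m ≤ 8 := by
  rcases eq_one_or_even_of_mulEquiv_dihedral e with rfl | ⟨n, rfl⟩
  · have hK : Module.finrank ℚ K = 2 := by
      rw [← IsGalois.card_aut_eq_finrank, Nat.card_congr e.toEquiv, DihedralGroup.nat_card]
    refine ⟨fun _ => by norm_num, fun _ X φ hX => ?_⟩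
    exact SmallDegreeAllTypes.isStablyNondegenerate_of_finrank_le_twelve (by omega) (fun _ => inferInstance)
      (fun h12 => by omega) φ hX
  · rw [← two_mul] at e
    rw [forall_isStablyNondegenerate_iff_dihedral e]
    omega

end Summit.HodgeConjecture.CorCM.GaloisDihedral

end
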